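import Summits.NavierStokesRegularity.NavierStokesRegularity.Theorems.HodographBetchovFastClassSqueezeMiddleStrain
import Summits.NavierStokesRegularity.NavierStokesRegularity.Theorems.HodographBetchovFastClassSqueezeWeylSplitTransfer
import Literature.Analysis.FluidPDE.TaoEnstrophyLocalisation

/-!
# `FastClassSqueeze` (stmt-NavierStokesRegularity-15832): Weyl continuity of the middle principal strain and
# measurability of its fast-class slices

Helper file for the line `Sketch-ideasK1` (idea `resolved-weyl-split`) of crux 3 of route `HodographBetchov`
(skeleton `Cruxes/FastClassSqueeze/Lines/Sketch-ideasK1.lean`, namespace `…Cruxes.FastClassSqueeze.GermWeyl`).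
Writing `λ₂(A) = strainEigenvalues A _ 1` for the middle principal strain of `A : ℝ³ →L[ℝ] ℝ³` (the tree's
`Literature.Analysis.FluidPDE.strainEigenvalues`, used inline — no new definition):

* §1 **Weyl for `λ₂`**: `λ₂(A) ≤ λ₂(A − B) + ‖B‖`, `|λ₂(A) − λ₂(B)| ≤ ‖A − B‖`, so `A ↦ λ₂(A)` is
  1-Lipschitz and continuous (Courant–Fischer two-plane form `middleStrain_le_iff` + the plane bound
  `WeylSplit.plane_form_le_add_opNorm`; Horn–Johnson Thm. 4.3.1);
* §2 **slices along a classical flow**: for a classical solution on `[0,T)` the field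
  `(t,x) ↦ λ₂(∇u(t,x))` is continuous on the slab, the space–time fast set `{(t,x) : a < t < T, l < |u(t,x)|}`
  is open, and `t ↦ ∫_{{l<|u(t)|} ∩ V} (ofReal λ₂(∇u(t,x)))^q dx` agrees on `(0,T)` with a measurable function
  (Tonelli after a piecewise extension) — the bookkeeping that lets lower Lebesgue integrals in time be split
  over a finite cover (stub `stub_germ_of_pointSqueeze`).

References: Horn–Johnson, Matrix Analysis (2013), Thm. 4.2.6 / 4.3.1 [HornJohnson2013]; E. Miller,
arXiv:1710.05569 Thm. 1.1 [Miller2019] for the role of `λ₂`.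
-/

noncomputable section

-- the summit and its single problem share the name `NavierStokesRegularity` (D-0017 nested layout)
set_option linter.dupNamespace false

namespace Summit.NavierStokesRegularity.NavierStokesRegularity.Theorems.FastClassSqueeze.GermWeyl

open Set MeasureTheory Filter Topology Metric Function Literature.Analysis.FluidPDE
open scoped ENNReal NNReal

/-! ### §1 Weyl's inequality for the middle principal strain -/

/-- **Weyl for the middle principal strain, one-sided:** `λ₂(A) ≤ λ₂(A − B) + ‖B‖` (a plane on which the
form of `A − B` is `≤ λ₂(A−B)` carries the form of `A` with bound `λ₂(A−B) + ‖B‖`).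
[cite: HornJohnson2013, Thm 4.3.1] -/
theorem middleStrain_le_middleStrain_sub_add_opNorm (A B : EuclideanSpace ℝ (Fin 3) →L[ℝ] EuclideanSpace ℝ (Fin 3)) :
    strainEigenvalues ((A : EuclideanSpace ℝ (Fin 3) →L[ℝ] EuclideanSpace ℝ (Fin 3)) : EuclideanSpace ℝ (Fin 3) →ₗ[ℝ] EuclideanSpace ℝ (Fin 3)) finrank_euclideanSpace_fin 1 ≤
      strainEigenvalues ((A - B : EuclideanSpace ℝ (Fin 3) →L[ℝ] EuclideanSpace ℝ (Fin 3)) : EuclideanSpace ℝ (Fin 3) →ₗ[ℝ] EuclideanSpace ℝ (Fin 3)) finrank_euclideanSpace_fin 1 + ‖B‖ := by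
  obtain ⟨v, w, hv, hw, hvw, h⟩ := (middleStrain_le_iff (A - B) _).1 le_rfl
  exact (middleStrain_le_iff A _).2 ⟨v, w, hv, hw, hvw, WeylSplit.plane_form_le_add_opNorm hv hw hvw h⟩

/-- **Weyl for the middle principal strain, difference form:** `λ₂(A) − λ₂(B) ≤ ‖A − B‖`.
[cite: HornJohnson2013, Thm 4.3.1] -/
theorem middleStrain_sub_middleStrain_le (A B : EuclideanSpace ℝ (Fin 3) →L[ℝ] EuclideanSpace ℝ (Fin 3)) :
    strainEigenvalues ((A : EuclideanSpace ℝ (Fin 3) →L[ℝ] EuclideanSpace ℝ (Fin 3)) : EuclideanSpace ℝ (Fin 3) →ₗ[ℝ] EuclideanSpace ℝ (Fin 3)) finrank_euclideanSpace_fin 1 -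
      strainEigenvalues ((B : EuclideanSpace ℝ (Fin 3) →L[ℝ] EuclideanSpace ℝ (Fin 3)) : EuclideanSpace ℝ (Fin 3) →ₗ[ℝ] EuclideanSpace ℝ (Fin 3)) finrank_euclideanSpace_fin 1 ≤ ‖A - B‖ := by
  have h := middleStrain_le_middleStrain_sub_add_opNorm A (A - B)
  rw [sub_sub_cancel] at h
  linarith

/-- **Weyl for the middle principal strain:** `|λ₂(A) − λ₂(B)| ≤ ‖A − B‖`. [cite: HornJohnson2013, Thm 4.3.1] -/
theorem abs_middleStrain_sub_middleStrain_le (A B : EuclideanSpace ℝ (Fin 3) →L[ℝ] EuclideanSpace ℝ (Fin 3)) :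
    |strainEigenvalues ((A : EuclideanSpace ℝ (Fin 3) →L[ℝ] EuclideanSpace ℝ (Fin 3)) : EuclideanSpace ℝ (Fin 3) →ₗ[ℝ] EuclideanSpace ℝ (Fin 3)) finrank_euclideanSpace_fin 1 -
      strainEigenvalues ((B : EuclideanSpace ℝ (Fin 3) →L[ℝ] EuclideanSpace ℝ (Fin 3)) : EuclideanSpace ℝ (Fin 3) →ₗ[ℝ] EuclideanSpace ℝ (Fin 3)) finrank_euclideanSpace_fin 1| ≤ ‖A - B‖ := by
  rw [abs_sub_le_iff]
  refine ⟨middleStrain_sub_middleStrain_le A B, ?_⟩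
  have h := middleStrain_sub_middleStrain_le B A
  rwa [norm_sub_rev] at h

/-- The middle principal strain is a 1-Lipschitz function of the operator. [cite: HornJohnson2013, Thm 4.3.1] -/
theorem lipschitzWith_middleStrain :
    LipschitzWith 1 fun A : EuclideanSpace ℝ (Fin 3) →L[ℝ] EuclideanSpace ℝ (Fin 3) =>
      strainEigenvalues ((A : EuclideanSpace ℝ (Fin 3) →L[ℝ] EuclideanSpace ℝ (Fin 3)) : EuclideanSpace ℝ (Fin 3) →ₗ[ℝ] EuclideanSpace ℝ (Fin 3)) finrank_euclideanSpace_fin 1 :=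
  LipschitzWith.of_dist_le_mul fun A B => by
    rw [NNReal.coe_one, one_mul, Real.dist_eq, dist_eq_norm]
    exact abs_middleStrain_sub_middleStrain_le A B

/-- The middle principal strain depends continuously on the operator. [cite: HornJohnson2013, Thm 4.3.1] -/
theorem continuous_middleStrain :
    Continuous fun A : EuclideanSpace ℝ (Fin 3) →L[ℝ] EuclideanSpace ℝ (Fin 3) =>
      strainEigenvalues ((A : EuclideanSpace ℝ (Fin 3) →L[ℝ] EuclideanSpace ℝ (Fin 3)) : EuclideanSpace ℝ (Fin 3) →ₗ[ℝ] EuclideanSpace ℝ (Fin 3)) finrank_euclideanSpace_fin 1 :=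
  lipschitzWith_middleStrain.continuous

/-! ### §2 Slices of `λ₂(∇u)` along a classical flow -/

variable {ν T : ℝ} {u : ℝ → EuclideanSpace ℝ (Fin 3) → EuclideanSpace ℝ (Fin 3)} {p : ℝ → EuclideanSpace ℝ (Fin 3) → ℝ}

/-- Along a classical solution on `[0,T)` the velocity gradient `(t,x) ↦ ∇u(t,x)` is continuous on the slab
`[0,T) × EuclideanSpace ℝ (Fin 3)`. [folklore] -/
theorem continuousOn_fderiv_slab (hcl : IsClassicalNSSolutionOn (Ico 0 T) ν 0 u p) :
    ContinuousOn (fun z : ℝ × EuclideanSpace ℝ (Fin 3) => fderiv ℝ (u z.1) z.2) (Ico 0 T ×ˢ univ) :=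
  (hcl.smooth_velocity.fderiv_slice (uniqueDiffOn_Ico 0 T)).continuousOn

/-- Along a classical solution on `[0,T)` the middle principal strain `(t,x) ↦ λ₂(∇u(t,x))` is continuous
on the slab `[0,T) × EuclideanSpace ℝ (Fin 3)`. [folklore] -/
theorem continuousOn_middleStrain_fderiv_slab (hcl : IsClassicalNSSolutionOn (Ico 0 T) ν 0 u p) :
    ContinuousOn (fun z : ℝ × EuclideanSpace ℝ (Fin 3) => strainEigenvalues
      ((fderiv ℝ (u z.1) z.2 : EuclideanSpace ℝ (Fin 3) →L[ℝ] EuclideanSpace ℝ (Fin 3)) : EuclideanSpace ℝ (Fin 3) →ₗ[ℝ] EuclideanSpace ℝ (Fin 3)) finrank_euclideanSpace_fin 1) (Ico 0 T ×ˢ univ) :=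
  continuous_middleStrain.comp_continuousOn (continuousOn_fderiv_slab hcl)

/-- Along a classical solution on `[0,T)` the speed `(t,x) ↦ |u(t,x)|` is continuous on `[0,T) × EuclideanSpace ℝ (Fin 3)`.
[folklore] -/
theorem continuousOn_norm_slab (hcl : IsClassicalNSSolutionOn (Ico 0 T) ν 0 u p) :
    ContinuousOn (fun z : ℝ × EuclideanSpace ℝ (Fin 3) => ‖u z.1 z.2‖) (Ico 0 T ×ˢ univ) :=
  hcl.smooth_velocity.continuousOn.norm

/-- **The space–time fast set is open.** For a classical solution on `[0,T)`, `0 ≤ a` and a level `l`, the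
set `{(t,x) : a < t < T, l < |u(t,x)|}` is open in `ℝ × EuclideanSpace ℝ (Fin 3)`. [folklore] -/
theorem isOpen_spaceTimeFast (hcl : IsClassicalNSSolutionOn (Ico 0 T) ν 0 u p) {a : ℝ} (ha : 0 ≤ a)
    (l : ℝ) : IsOpen {z : ℝ × EuclideanSpace ℝ (Fin 3) | z.1 ∈ Ioo a T ∧ l < ‖u z.1 z.2‖} := by
  have hO : IsOpen (Ioo a T ×ˢ (univ : Set (EuclideanSpace ℝ (Fin 3)))) := isOpen_Ioo.prod isOpen_univ
  have hsub : Ioo a T ×ˢ (univ : Set (EuclideanSpace ℝ (Fin 3))) ⊆ Ico 0 T ×ˢ univ :=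
    prod_mono (fun t ht => ⟨ha.trans ht.1.le, ht.2⟩) Subset.rfl
  have hcont : ContinuousOn (fun z : ℝ × EuclideanSpace ℝ (Fin 3) => ‖u z.1 z.2‖) (Ioo a T ×ˢ (univ : Set (EuclideanSpace ℝ (Fin 3)))) :=
    (continuousOn_norm_slab hcl).mono hsub
  have heq : {z : ℝ × EuclideanSpace ℝ (Fin 3) | z.1 ∈ Ioo a T ∧ l < ‖u z.1 z.2‖} =
      (Ioo a T ×ˢ (univ : Set (EuclideanSpace ℝ (Fin 3)))) ∩ (fun z : ℝ × EuclideanSpace ℝ (Fin 3) => ‖u z.1 z.2‖) ⁻¹' Ioi l := by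
    ext z
    simp only [mem_setOf_eq, mem_inter_iff, mem_prod, mem_univ, and_true, mem_preimage, mem_Ioi]
  rw [heq]
  exact hcont.isOpen_inter_preimage hO isOpen_Ioi

/-- The fast class `{x : l < |u(t,x)|}` of a classical slice, `t ∈ [0,T)`, is measurable. [folklore] -/
theorem measurableSet_fast (hcl : IsClassicalNSSolutionOn (Ico 0 T) ν 0 u p) {t : ℝ} (ht : t ∈ Ico 0 T)
    (l : ℝ) : MeasurableSet {x : EuclideanSpace ℝ (Fin 3) | l < ‖u t x‖} :=
  measurableSet_lt measurable_const (hcl.contDiff_velocity ht).continuous.norm.measurable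

/-- **Measurable-in-time fast-class slices of `λ₂(∇u)`.** For a classical solution on `[0,T)`, a measurable
`V ⊆ EuclideanSpace ℝ (Fin 3)`, a level `l` and an exponent `q`, the slice functional
`t ↦ ∫_{{l<|u(t)|} ∩ V} (ofReal λ₂(∇u(t,x)))^q dx` agrees on `(0,T)` with a measurable function `ℝ → ℝ≥0∞`
(the integrand, extended by `0` off the open slab `(0,T) × EuclideanSpace ℝ (Fin 3)` and off the open space–time fast set, is jointly
measurable; Tonelli). [folklore] -/
theorem exists_measurable_middleStrain_slice (hcl : IsClassicalNSSolutionOn (Ico 0 T) ν 0 u p)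
    {V : Set (EuclideanSpace ℝ (Fin 3))} (hV : MeasurableSet V) (l q : ℝ) :
    ∃ G : ℝ → ℝ≥0∞, Measurable G ∧ ∀ t ∈ Ioo 0 T,
      G t = ∫⁻ x in {x : EuclideanSpace ℝ (Fin 3) | l < ‖u t x‖} ∩ V, ENNReal.ofReal (strainEigenvalues
        ((fderiv ℝ (u t) x : EuclideanSpace ℝ (Fin 3) →L[ℝ] EuclideanSpace ℝ (Fin 3)) : EuclideanSpace ℝ (Fin 3) →ₗ[ℝ] EuclideanSpace ℝ (Fin 3)) finrank_euclideanSpace_fin 1) ^ q := by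
  classical
  -- the integrand, made measurable by a piecewise extension off the slab
  set S : Set (ℝ × EuclideanSpace ℝ (Fin 3)) := Ioo 0 T ×ˢ univ with hS
  have hSm : MeasurableSet S := measurableSet_Ioo.prod MeasurableSet.univ
  set g : ℝ × EuclideanSpace ℝ (Fin 3) → ℝ≥0∞ := fun z => ENNReal.ofReal (strainEigenvalues
    ((fderiv ℝ (u z.1) z.2 : EuclideanSpace ℝ (Fin 3) →L[ℝ] EuclideanSpace ℝ (Fin 3)) : EuclideanSpace ℝ (Fin 3) →ₗ[ℝ] EuclideanSpace ℝ (Fin 3)) finrank_euclideanSpace_fin 1) ^ q with hg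
  have hgcont : ContinuousOn g S := by
    have h1 : ContinuousOn (fun z : ℝ × EuclideanSpace ℝ (Fin 3) => ENNReal.ofReal (strainEigenvalues
        ((fderiv ℝ (u z.1) z.2 : EuclideanSpace ℝ (Fin 3) →L[ℝ] EuclideanSpace ℝ (Fin 3)) : EuclideanSpace ℝ (Fin 3) →ₗ[ℝ] EuclideanSpace ℝ (Fin 3)) finrank_euclideanSpace_fin 1)) S :=
      (ENNReal.continuous_ofReal.comp_continuousOn (continuousOn_middleStrain_fderiv_slab hcl)).mono
        (prod_mono Ioo_subset_Ico_self Subset.rfl)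
    exact (ENNReal.continuous_rpow_const (y := q)).comp_continuousOn h1
  have hpw : Measurable (S.piecewise g fun _ => 0) := hgcont.measurable_piecewise continuousOn_const hSm
  -- the space–time fast set inside `(0,T) × V`
  set W : Set (ℝ × EuclideanSpace ℝ (Fin 3)) := {z : ℝ × EuclideanSpace ℝ (Fin 3) | z.1 ∈ Ioo 0 T ∧ l < ‖u z.1 z.2‖} ∩ Prod.snd ⁻¹' V with hW
  have hWm : MeasurableSet W :=
    (isOpen_spaceTimeFast hcl le_rfl l).measurableSet.inter (measurable_snd hV)
  have hmeas : Measurable (W.indicator (S.piecewise g fun _ => 0)) := hpw.indicator hWm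
  refine ⟨fun t => ∫⁻ x, W.indicator (S.piecewise g fun _ => 0) (t, x), hmeas.lintegral_prod_right',
    fun t ht => ?_⟩
  have hF : MeasurableSet ({x : EuclideanSpace ℝ (Fin 3) | l < ‖u t x‖} ∩ V) :=
    (measurableSet_fast hcl (Ioo_subset_Ico_self ht) l).inter hV
  rw [← lintegral_indicator hF]
  refine lintegral_congr fun x => ?_
  by_cases hx : x ∈ {x : EuclideanSpace ℝ (Fin 3) | l < ‖u t x‖} ∩ V
  · have hzW : (t, x) ∈ W := ⟨⟨ht, hx.1⟩, hx.2⟩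
    have hzS : (t, x) ∈ S := ⟨ht, mem_univ _⟩
    rw [indicator_of_mem hzW, indicator_of_mem hx, piecewise_eq_of_mem _ _ _ hzS]
  · have hzW : (t, x) ∉ W := fun h => hx ⟨h.1.2, h.2⟩
    rw [indicator_of_notMem hzW, indicator_of_notMem hx]

/-! ### Registered tools stub -/

/-- **Registered tools stub of the line `Sketch-ideasK1`** (`ledger workitem stub-add stmt-NavierStokesRegularity-15832
--name stub_germWeylTools`): the conjunction of this file's Weyl bound for `λ₂`, its Lipschitz continuity, and
the measurable-in-time fast-class slices of `λ₂(∇u)` along a classical flow. [folklore] -/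
theorem stub_germWeylTools :
    (∀ A B : EuclideanSpace ℝ (Fin 3) →L[ℝ] EuclideanSpace ℝ (Fin 3), Literature.Analysis.FluidPDE.strainEigenvalues ((A : EuclideanSpace ℝ (Fin 3) →L[ℝ] EuclideanSpace ℝ (Fin 3)) : EuclideanSpace ℝ (Fin 3) →ₗ[ℝ] EuclideanSpace ℝ (Fin 3)) finrank_euclideanSpace_fin 1 ≤ Literature.Analysis.FluidPDE.strainEigenvalues ((A - B : EuclideanSpace ℝ (Fin 3) →L[ℝ] EuclideanSpace ℝ (Fin 3)) : EuclideanSpace ℝ (Fin 3) →ₗ[ℝ] EuclideanSpace ℝ (Fin 3)) finrank_euclideanSpace_fin 1 + ‖B‖) ∧ (LipschitzWith 1 fun A : EuclideanSpace ℝ (Fin 3) →L[ℝ] EuclideanSpace ℝ (Fin 3) => Literature.Analysis.FluidPDE.strainEigenvalues ((A : EuclideanSpace ℝ (Fin 3) →L[ℝ] EuclideanSpace ℝ (Fin 3)) : EuclideanSpace ℝ (Fin 3) →ₗ[ℝ] EuclideanSpace ℝ (Fin 3)) finrank_euclideanSpace_fin 1) ∧ (∀ (ν T : ℝ) (u : ℝ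 → EuclideanSpace ℝ (Fin 3) → EuclideanSpace ℝ (Fin 3)) (p : ℝ → EuclideanSpace ℝ (Fin 3) → ℝ), Literature.Analysis.FluidPDE.IsClassicalNSSolutionOn (Set.Ico 0 T) ν 0 u p → ∀ V : Set (EuclideanSpace ℝ (Fin 3)), MeasurableSet V → ∀ l q : ℝ, ∃ G : ℝ → ENNReal, Measurable G ∧ ∀ t ∈ Set.Ioo 0 T, G t = ∫⁻ x in {x : EuclideanSpace ℝ (Fin 3) | l < ‖u t x‖} ∩ V, ENNReal.ofReal (Literature.Analysis.FluidPDE.strainEigenvalues ((fderiv ℝ (u t) x : EuclideanSpace ℝ (Fin 3) →L[ℝ] EuclideanSpace ℝ (Fin 3)) : EuclideanSpace ℝ (Fin 3) →ₗ[ℝ] EuclideanSpace ℝ (Fin 3)) finrank_euclideanSpace_fin 1) ^ q) :=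
  ⟨middleStrain_le_middleStrain_sub_add_opNorm, lipschitzWith_middleStrain,
    fun _ν _T _u _p hcl _V hV l q => exists_measurable_middleStrain_slice hcl hV l q⟩

end Summit.NavierStokesRegularity.NavierStokesRegularity.Theorems.FastClassSqueeze.GermWeyl

end
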